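import Literature.InformationTheory.QuantumCodes.QuaternaryMacWilliams
import Literature.InformationTheory.QuantumCodes.AdditiveCodeShortening
import HarnessLib

/-!
# The linear-programming bound for all additive quantum codes (CRSS Theorem 21 with Theorem 6 (e)) — proofs

Topic `Literature/InformationTheory/QuantumCodes` (venture QEC, cell `qec`, row 06 / item 06.LPK; the file name
planned in PARTITION row 06 for the LP bounds). CRSS state their LP bound (Thm. 21, PROVED in
`QuaternaryMacWilliams.lean` as `CRSS1998_theorem21_LP_holds`) under the proviso that the associated code `C` has no
vector of weight `1`, having remarked «In view of Theorem 6(e), we may assume that `A_1 = 0`»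
[CalderbankEtAl1998, §7, printed p. 26]. With Theorem 6 (e) PROVED (`CRSS1998_theorem6e`,
`AdditiveCodeShortening.lean`) this file records the resulting bound for ALL additive codes and the two bookkeeping
lemmas by which the code tables are filled column by column («Unmarked lower bounds are from Theorem 6 … All unmarked
upper bounds in the table come from the linear programming bound of Theorem 21», §8 printed pp. 29–30):

* `CRSSLPFeasible.anti` — feasibility of (16)–(21) at `d` implies feasibility at every `d′ ≤ d`;
* `AdditiveCodeExists.exists_crssLPFeasible` — an `[[n,k,d]]` yields, for some `m ≤ n`, an `[[m,k,d]]` without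
  weight-one stabilizer words, whence `CRSSLPFeasible m k d`;
* `not_additiveCodeExists_succ` — the column step: `¬[[m,k,d]]`, LP infeasible at `(m+1,k,d′)`, `d ≤ d′` ⟹
  `¬[[m+1,k,d′]]`; `not_additiveCodeExists_of_lt` (`k > n`), `not_additiveCodeExists_of_singleton` (quantum
  Singleton, `QuantumSingletonBound.lean`) — the tops of the columns.

The kernel-checked certificates `lp_n_k : ¬ CRSSLPFeasible n k (d_LP+1)` live Summits-side
(`Summits/Ventures/QEC/Census/LPBounds/`); with this file they become `¬ AdditiveCodeExists n k (d_LP+1)`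
(`Census/LPBounds/NoCode….lean`). Deliberately NOT here: any specific `(n,k)`; non-additive codes.
Reference: [CalderbankEtAl1998] (read via `lit`, arXiv:quant-ph/9608006v5, PDF pp. 14, 27, 30–31).
-/

namespace Literature.InformationTheory.QuantumCodes

open Finset

/-! ### The LP bound for all additive codes -/

section LPBound

/-- **LP feasibility is antitone in `d`**: the system (16)–(21) at `d` implies the system at every `d′ ≤ d` (for
`d′ ≤ j < d` the equality `A_j = A′_j` gives the inequality `A_j ≤ A′_j`). [cite: CalderbankEtAl1998, §7 Thm. 21 (printed p. 26)] -/
theorem CRSSLPFeasible.anti {n k d d' : ℕ} (h : CRSSLPFeasible n k d) (hd : d' ≤ d) : CRSSLPFeasible n k d' := by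
  obtain ⟨A, h0, h1, hpos, hsum, heq, hle, hpar, hsh⟩ := h
  refine ⟨A, h0, h1, hpos, hsum, fun j hj => heq j (by omega), fun j hj hjn => ?_, hpar, hsh⟩
  by_cases hjd : j + 1 ≤ d
  · exact (heq j hjd).le
  · exact hle j (by omega) hjn

/-- **CRSS's LP bound for ALL additive codes** (Theorem 21 with Theorem 6 (e): «In view of Theorem 6(e), we may
assume that `A_1 = 0`»): if an `[[n,k,d]]` additive code exists, then for some `m ≤ n` an `[[m,k,d]]` additive code
exists whose stabilizer space has no word of weight `1`, and the system (16)–(21) is feasible at `(m,k,d)`.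
Column: PROVED. [cite: CalderbankEtAl1998, §7 Thm. 21 and the paragraph before it (printed p. 26)] -/
theorem AdditiveCodeExists.exists_crssLPFeasible {n k d : ℕ} (h : AdditiveCodeExists n k d) :
    ∃ m, m ≤ n ∧ AdditiveCodeExists m k d ∧ CRSSLPFeasible m k d := by
  induction n with
  | zero =>
    obtain ⟨S, hS⟩ := h
    refine ⟨0, le_rfl, ⟨S, hS⟩, CRSS1998_theorem21_LP_holds 0 k d S hS fun v _ h1 => ?_⟩
    have := sympWeight_le v
    omega
  | succ m ih =>
    rcases h.noWeightOne_or_shorten with ⟨S, hS, hw⟩ | h'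
    · exact ⟨m + 1, le_rfl, ⟨S, hS⟩, CRSS1998_theorem21_LP_holds (m + 1) k d S hS hw⟩
    · obtain ⟨m', hm', hc, hlp⟩ := ih h'
      exact ⟨m', by omega, hc, hlp⟩

/-- **The column step of the code tables** («the entries in the same column using Theorem 6»): if no `[[m,k,d]]`
exists and CRSS's LP system is infeasible at `(m+1, k, d′)` with `d ≤ d′`, then no `[[m+1,k,d′]]` exists — a
code with a weight-one stabilizer word would shorten to an `[[m,k,d′]] ⊆ [[m,k,d]]` (Thm. 6 (e)), one without
satisfies the LP (Thm. 21). Column: PROVED. [cite: CalderbankEtAl1998, §7 Thm. 21 with §4 Thm. 6 (e) (printed pp. 13, 26)] -/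
theorem not_additiveCodeExists_succ {m k d d' : ℕ} (hprev : ¬ AdditiveCodeExists m k d)
    (hlp : ¬ CRSSLPFeasible (m + 1) k d') (hdd : d ≤ d') : ¬ AdditiveCodeExists (m + 1) k d' := by
  intro h
  rcases h.noWeightOne_or_shorten with ⟨S, hS, hw⟩ | h'
  · exact hlp (CRSS1998_theorem21_LP_holds (m + 1) k d' S hS hw)
  · obtain ⟨S, hS⟩ := h'
    exact hprev ⟨S, hS.mono hdd⟩

/-- No `[[n,k,d]]` with `k > n` (`dim S̄ = n − k ≥ 0`). [cite: CalderbankEtAl1998, §2 Thm. 2 (printed p. 9)] -/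
theorem not_additiveCodeExists_of_lt {n k d : ℕ} (h : n < k) : ¬ AdditiveCodeExists n k d :=
  fun hc => absurd hc.le (by omega)

/-- No `[[n,k,d]]`, `k ≥ 1`, beyond the quantum Singleton bound `k + 2d ≤ n + 2` (the tree's
`AdditiveCodeExists.quantumSingleton`). [cite: CalderbankEtAl1998, §7 eq. (15) (printed p. 26); Rains1999Nonbinary, Thm. 2] -/
theorem not_additiveCodeExists_of_singleton {n k d : ℕ} (hk : 1 ≤ k) (h : n + 2 < k + 2 * d) :
    ¬ AdditiveCodeExists n k d :=
  fun hc => absurd (hc.quantumSingleton hk) (by omega)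

end LPBound

/-! ### The `k = 0` column: self-dual additive codes satisfy Rains's pure system (`K = 1`) -/

section SelfDual

open scoped Classical in
/-- A self-orthogonal `S̄` with `dim S̄ = n` is self-dual: `S̄⊥ = S̄` (`dim S̄⊥ = 2n − n`).
[cite: CalderbankEtAl1998, §3 (printed p. 10: an [[n,0,d]] code is a self-dual (n, 2^n) code)] -/
theorem sympDual_eq_of_isAdditiveCode_zero {n d : ℕ} {S : Submodule (ZMod 2) (SympVec n)}
    (h : IsAdditiveCode S 0 d) : sympDual S = S := by
  obtain ⟨hso, hdim, -, -⟩ := h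
  have hfin : Module.finrank (ZMod 2) (sympDual S) = Module.finrank (ZMod 2) S := by
    have := finrank_sympDual_add S; omega
  exact (Submodule.eq_of_le_of_finrank_eq hso hfin.symm).symm

/-- `Σ_r (−1)^r P_j(r,n) A_r = 2 Σ_{r even} P_j(r,n) A_r − Σ_r P_j(r,n) A_r` (the shadow combination as an even-part
sum). [cite: CalderbankEtAl1998, §7 Thm. 21 eq. (21); Rains1999Shadow, Thm. 10 (S_i)] -/
theorem sum_neg_one_pow_mul_eq {n : ℕ} (x : ℕ → ℝ) :
    ∑ r ∈ range (n + 1), (-1 : ℝ) ^ r * x r =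
      2 * ∑ r ∈ (range (n + 1)).filter Even, x r - ∑ r ∈ range (n + 1), x r := by
  rw [Finset.sum_filter, Finset.mul_sum, ← Finset.sum_sub_distrib]
  refine Finset.sum_congr rfl fun r _ => ?_
  rcases Nat.even_or_odd r with he | ho
  · rw [he.neg_one_pow, if_pos he]; ring
  · rw [ho.neg_one_pow, if_neg (Nat.not_even_iff_odd.2 ho)]; ring

/-- **Self-dual additive codes satisfy Rains's LP system with purity, `K = 1`.** For an `[[n,0,d]]` additive code
(CRSS: self-dual `S̄ = S̄⊥`, pure to weight `d` by convention) the weight distribution `A_j = #{v ∈ S̄ : wt v = j}`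
solves `RainsLPFeasiblePure n 1 d`: `A_0 = 1 = K²`; `A_j ≥ 0`; `A_j = 0` for `1 ≤ j < d` (purity); `A_j = K B_j` for
ALL `j` (MacWilliams, `S̄⊥ = S̄`, `|S̄| = 2ⁿ`; in particular the equalities below `d` and the inequalities above);
`S_j ≥ 0` (the additive shadow: `Σ_r (−1)^r P_j(r) A_r = 2|C′| #{(C′)⊥, wt j} − |C| #{C⊥, wt j} ≥ 0`). This is the
additive case of Rains's Thm. 10 with its Remark (pure codes), i.e. the bridge by which the kernel certificates
`¬ RainsLPFeasiblePure n 1 d` refute `[[n,0,d]]` unconditionally. Column: PROVED.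
[cite: Rains1999Shadow, §2 («Additive codes … A_d and B_d have combinatorial interpretations») and Thm. 10 with the Remark after it; CalderbankEtAl1998, §7 Thm. 21] -/
theorem IsAdditiveCode.rainsLPFeasiblePure_zero {n d : ℕ} {S : Submodule (ZMod 2) (SympVec n)}
    (h : IsAdditiveCode S 0 d) : RainsLPFeasiblePure n 1 d := by
  classical
  have hS : IsSelfOrthogonal S := h.1
  have hN : Module.finrank (ZMod 2) S = n := by have := h.2.1; omega
  have hdual : sympDual S = S := sympDual_eq_of_isAdditiveCode_zero h
  have hcardR : (#(codeWords S) : ℝ) = (2 : ℝ) ^ n := by rw [card_codeWords S, hN]; push_cast; rfl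
  have hce := card_evenSub S hS
  -- MacWilliams with `S̄⊥ = S̄`: `B_j = A_j`
  have hB : ∀ j, ((1 : ℕ) : ℝ) * rainsDual n (fun i => (wtDist S i : ℝ)) j = (wtDist S j : ℝ) := by
    intro j
    unfold rainsDual
    rw [Nat.cast_one, one_mul, sum_krawtchouk4_mul_wtDist_real, hcardR, hdual, ← mul_assoc,
      one_div_mul_cancel (pow_ne_zero _ two_ne_zero), one_mul]
  refine ⟨fun j => (wtDist S j : ℝ), ?_, ?_, ?_, ?_, ?_, ?_⟩
  -- A_0 = K² = 1
  · simp [wtDist_zero]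
  -- A_j ≥ 0
  · intro j _; exact Nat.cast_nonneg _
  -- purity: A_j = 0 for 1 ≤ j < d
  · intro j hj1 hjd
    have h0 : wtDist S j = 0 := by
      rw [wtDist, Finset.card_eq_zero, Finset.filter_eq_empty_iff]
      intro v hv hwt
      have hv0 : v ≠ 0 := fun h0 => by
        rw [h0, (sympWeight_eq_zero_iff _).2 rfl] at hwt; omega
      have := h.2.2.2 rfl v (mem_codeWords.1 hv) hv0
      omega
    beta_reduce; exact_mod_cast h0
  -- A_j = K B_j for j < d (in fact for all j)
  · intro j _; beta_reduce; exact (hB j).symm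
  -- A_j ≤ K B_j for d ≤ j ≤ n
  · intro j _ _; beta_reduce; exact (hB j).symm.le
  -- S_j ≥ 0
  · intro j _
    unfold rainsShadow
    refine mul_nonneg (by positivity) ?_
    have hx : ∀ r, (-1 : ℝ) ^ r * (krawtchouk4 n j r : ℝ) * (wtDist S r : ℝ) =
        (-1 : ℝ) ^ r * ((krawtchouk4 n j r : ℝ) * (wtDist S r : ℝ)) := fun r => by ring
    simp only [hx]
    rw [sum_neg_one_pow_mul_eq, sum_krawtchouk4_mul_wtDist_real]
    -- the even part is the MacWilliams transform of `C′`
    have heven : ∑ r ∈ (range (n + 1)).filter Even, (krawtchouk4 n j r : ℝ) * (wtDist S r : ℝ) =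
        (#(codeWords (evenSub S hS)) : ℝ) * (wtDist (sympDual (evenSub S hS)) j : ℝ) := by
      rw [← sum_krawtchouk4_mul_wtDist_real (evenSub S hS) j]
      have h1 := sum_codeWords_filter_eq_sum_wtDist S Even (fun r => (krawtchouk4 n j r : ℝ))
      have h2 := sum_codeWords_eq_sum_wtDist (evenSub S hS) (fun r => (krawtchouk4 n j r : ℝ))
      simp only [nsmul_eq_mul] at h1 h2
      rw [Finset.sum_congr rfl fun r _ => mul_comm ((krawtchouk4 n j r : ℝ)) _, ← h1,
        Finset.sum_congr rfl fun r _ => mul_comm ((krawtchouk4 n j r : ℝ)) _, ← h2, codeWords_evenSub]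
    rw [heven]
    have hle1 : wtDist (sympDual S) j ≤ wtDist (sympDual (evenSub S hS)) j :=
      wtDist_sympDual_mono (evenSub_le S hS) j
    have hle2 : #(codeWords S) ≤ 2 * #(codeWords (evenSub S hS)) := by
      rcases hce with hall | hhalf <;> omega
    have hle : #(codeWords S) * wtDist (sympDual S) j ≤
        2 * #(codeWords (evenSub S hS)) * wtDist (sympDual (evenSub S hS)) j :=
      Nat.mul_le_mul hle2 hle1
    have hcast : ((#(codeWords S) * wtDist (sympDual S) j : ℕ) : ℝ) ≤
        ((2 * #(codeWords (evenSub S hS)) * wtDist (sympDual (evenSub S hS)) j : ℕ) : ℝ) := by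
      exact_mod_cast hle
    push_cast at hcast
    linarith

/-- **No `[[n,0,d]]` where Rains's pure system (`K = 1`) is infeasible** — the additive reading of the `k = 0` kernel
certificates, UNCONDITIONAL. [cite: Rains1999Shadow, Thm. 10 (Remark); CalderbankEtAl1998, §8 Table III (k = 0 column)] -/
theorem not_additiveCodeExists_zero_of_not_rainsLPFeasiblePure {n d : ℕ} (h : ¬ RainsLPFeasiblePure n 1 d) :
    ¬ AdditiveCodeExists n 0 d :=
  fun ⟨_, hS⟩ => h hS.rainsLPFeasiblePure_zero

end SelfDual

end Literature.InformationTheory.QuantumCodes
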